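import Summits.Ventures.LatticeQCDFlow.Scaling.GraphSchemeMixingLaw
import Summits.Ventures.LatticeQCDFlow.Scaling.GroundStateShape

/-!
HONEST FRAMING: exact (Metropolis-corrected) sampling algorithms for lattice gauge theory; figures
of merit are autocorrelation/cost numbers at stated couplings and volumes; no continuum-physics
claim.

# GraphSchemeSharpLaw — THE TWO-SIDED LAW OF THE HOMOGENEOUS EXCHANGE SCHEME ON ANY CONNECTED SWAP LIST IN CLOSED FORM:
# **`((1−ρ)/ρ)·log((1−ν(u))·Σ_kc_k/(4√(Σ_kc_k²))) ≤ t_mix(1/4) ≤ ⌈(1/ρ)·log(4h/ρ)⌉`** — Wilson's increments are bounded by the ENERGY `ρΣc²` itself (so `D² = Σc²`), the ceiling's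
# `Σc/c_min` IS `h/ρ` (hot minimum + trace identity); `h = (1−t)w_0` (lean-2 GEN-48, ours)

Venture-side (OURS).  Cell `lqcd-flow` (pub-lqcd), unit `pub-lqcd-lean-2-g48`, 2026-08-31.  Chapter AI (the sizes of the Robin ground state), file 4 — parents AH9 `GraphSchemeMixingLaw`
(AH2's Wilson floor, AH7's freshness ceiling, AH8's ground state) and AI2 `GroundStateShape` (AI1's identities).  Chapter AH's two-sided law `((1−ρ)/ρ)·log((1−ν(u))Σc/(4D)) ≤ t_mix(1/4)
≤ ⌈(1/ρ)·log(4Σc/c_min)⌉` took an edge bound `Δ ≥ (c_{i_r} − c_{l_r})²` with `D² ≥ (tΔ + hc_0²)/ρ` and a lower bound `c_min`.  Both are now read off the solution itself: (§1) the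
one-step expected square increment of `Φ = Σ_kc_ka(x_k)` is at most `(t/m)Σ_r(c_{i_r} − c_{l_r})² + hc_0²` — the AVERAGE over the listed pairs, not the maximum — which is `ρΣ_kc_k²` by
AI1's energy identity, so `D² = Σc²` serves for every topology (§2, AF1 at defect `0` as in AH2); (§3) AI2's hot minimum `c_min = c_0` and AI1's trace identity `ρΣc = hc_0` make AH7's
ceiling `⌈(1/ρ)·log(4h/ρ)⌉`.  (§4) With AH8: on every connected list the law holds for THE ground state (unique rate by AI1), `0 < ρ ≤ h/(K+1)`; the floor's logarithm is that of the
participation number `(Σc)²/Σc² ∈ [1, K+1]` of the ground state (AI2 bounds it below by `h/(ρ(1 + L·mh/t))`), the ceiling's is `log(4h/ρ)` — both sides explicit in `ρ` and the shape.  No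
definitions.

* §1 `graphScheme_oneLevel_increment_le_energy`; §2 `graphScheme_mode_mixingTime_ge_energy`; §3 `graphScheme_sharp_two_sided_mode`; §4 `graphScheme_sharp_two_sided_exists`.

Reading (no numerics implied): for the complete list (AH10) the floor's logarithm was `O(1)` with the crude `Δ`; with `D² = Σc²` it is `log((1−ν(u))(x+K)/(4√(x²+K))) ≍ ½log K` — the
coupon-collector logarithm of the hub–complete interpolation is now on both sides (file 5).  Literature grade (cell rule): OWN; nothing cited; no new bib keys.
-/

noncomputable section

open Finset Function Real
open Literature.Probability.MarkovChains

namespace Summit.Ventures.LatticeQCDFlow.Scaling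

variable {S : Type*} [Fintype S] [DecidableEq S] {K m : ℕ} (e : Fin m → Fin (K + 1) × Fin (K + 1)) {ν : S → ℝ} {M : Fin (K + 1) → S → S → ℝ} {w : Fin (K + 1) → ℝ} {t : ℝ}
  {P : (Fin (K + 1) → S) → (Fin (K + 1) → S) → ℝ}

/-! ## §1 Wilson's increments are bounded by the energy -/

/-- **SHARP INCREMENTS:** `(a(v) − a(v'))² ≤ 1` ⇒ **`Σ_yP(x,y)(Φ(y) − Φ(x))² ≤ (t/m)Σ_r(c_{i_r} − c_{l_r})² + (1−t)w_0c_0²`** for `Φ = Σ_kc_ka(x_k)` (`0 ≤ t ≤ 1`, `w_0 ≥ 0`). [ours] -/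
theorem graphScheme_oneLevel_increment_le_energy (hm : 1 ≤ m) (he : ∀ r, (e r).1 ≠ (e r).2) (hν : ∀ v, 0 < ν v) (hν1 : ∑ v, ν v = 1)
    (hM0 : ∀ u v, M 0 u v = ν v) (hidle : ∀ i : Fin K, ∀ u v, M i.succ u v = if v = u then 1 else 0)
    (hw0 : 0 ≤ w 0) (hw1 : ∑ k, w k = 1) (ht0 : 0 ≤ t) (ht1 : t ≤ 1)
    (hP : ∀ x y, P x y = t * ptGraphSwap (fun _ : Fin (K + 1) => ν) e (fun _ => Equiv.refl S) x y + (1 - t) * prodKernel w M x y)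
    {c : Fin (K + 1) → ℝ} {a : S → ℝ} {Φ : (Fin (K + 1) → S) → ℝ} (hΦ : ∀ x, Φ x = ∑ k : Fin (K + 1), c k * a (x k))
    (ha : ∀ v v', (a v - a v') ^ 2 ≤ 1) (x : Fin (K + 1) → S) :
    ∑ y, P x y * (Φ y - Φ x) ^ 2 ≤ t / m * ∑ r : Fin m, (c (e r).1 - c (e r).2) ^ 2 + (1 - t) * w 0 * c 0 ^ 2 := by
  have hmpos : (0 : ℝ) < m := Nat.cast_pos.mpr (by omega)
  rw [graphScheme_sum_mul e hm he hν hM0 hidle hw1 hP x (fun y => (Φ y - Φ x) ^ 2)]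
  simp only [sub_self]
  -- the swap part, pair by pair
  have hsw : ∑ r : Fin m, (Φ (edgeFlowSwap (Equiv.refl S) (e r).1 (e r).2 x) - Φ x) ^ 2 ≤ ∑ r : Fin m, (c (e r).1 - c (e r).2) ^ 2 := by
    refine sum_le_sum fun r _ => ?_
    rw [oneLevelFin_edgeSwap hΦ (he r) x, add_sub_cancel_left, mul_pow]
    calc (c (e r).1 - c (e r).2) ^ 2 * (a (x (e r).2) - a (x (e r).1)) ^ 2 ≤ (c (e r).1 - c (e r).2) ^ 2 * 1 :=
          mul_le_mul_of_nonneg_left (ha _ _) (sq_nonneg _)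
      _ = (c (e r).1 - c (e r).2) ^ 2 := mul_one _
  -- the hot part (AG2's update identity, `ℕ`-indexed weights)
  obtain ⟨c', hc'⟩ : ∃ c' : ℕ → ℝ, ∀ k : Fin (K + 1), c' k = c k :=
    ⟨fun n => if hn : n < K + 1 then c ⟨n, hn⟩ else 0, fun k => by simp only [dif_pos k.2, Fin.eta]⟩
  have hΦ' : ∀ y, Φ y = ∑ k : Fin (K + 1), c' k * a (y k) := fun y => (hΦ y).trans (sum_congr rfl fun k _ => by rw [hc'])
  have h0 : c' 0 = c 0 := by simpa only [Fin.val_zero] using hc' 0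
  have hrd : ∑ v, ν v * (Φ (update x 0 v) - Φ x) ^ 2 ≤ c 0 ^ 2 := by
    have hv : ∀ v, ν v * (Φ (update x 0 v) - Φ x) ^ 2 ≤ ν v * c 0 ^ 2 := by
      intro v
      rw [oneLevel_update_zero hΦ' x v, h0, add_sub_cancel_left, mul_pow]
      refine mul_le_mul_of_nonneg_left ?_ (hν v).le
      calc c 0 ^ 2 * (a v - a (x 0)) ^ 2 ≤ c 0 ^ 2 * 1 := mul_le_mul_of_nonneg_left (ha v (x 0)) (sq_nonneg _)
        _ = c 0 ^ 2 := mul_one _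
    calc ∑ v, ν v * (Φ (update x 0 v) - Φ x) ^ 2 ≤ ∑ v, ν v * c 0 ^ 2 := sum_le_sum fun v _ => hv v
      _ = c 0 ^ 2 := by rw [← sum_mul, hν1, one_mul]
  have e0 : ((0 : ℝ)) ^ 2 = 0 := by norm_num
  rw [e0, mul_zero, add_zero]
  have h1 : t / m * ∑ r : Fin m, (Φ (edgeFlowSwap (Equiv.refl S) (e r).1 (e r).2 x) - Φ x) ^ 2 ≤ t / m * ∑ r : Fin m, (c (e r).1 - c (e r).2) ^ 2 :=
    mul_le_mul_of_nonneg_left hsw (by positivity)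
  have h2 : (1 - t) * (w 0 * ∑ v, ν v * (Φ (update x 0 v) - Φ x) ^ 2) ≤ (1 - t) * w 0 * c 0 ^ 2 := by
    rw [mul_assoc]; exact mul_le_mul_of_nonneg_left (mul_le_mul_of_nonneg_left hrd hw0) (by linarith)
  linarith

/-! ## §2 Wilson's floor with `D² ≥ energy/ρ` -/

/-- **WILSON'S FLOOR WITH THE ENERGY:** as chapter AH file 2, but with `D² ≥ ((t/m)Σ_r(c_{i_r} − c_{l_r})² + (1−t)w_0c_0²)/ρ` in place of the edge-maximum bound:
**`((1−ρ)/ρ)·log((1−ν(u))·|Σ_kc_k|/(4D)) ≤ t_mix(1/4)`**. [ours] -/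
theorem graphScheme_mode_mixingTime_ge_energy (hm : 1 ≤ m) (he : ∀ r, (e r).1 ≠ (e r).2) (hν : ∀ v, 0 < ν v) (hν1 : ∑ v, ν v = 1)
    (hM0 : ∀ u v, M 0 u v = ν v) (hidle : ∀ i : Fin K, ∀ u v, M i.succ u v = if v = u then 1 else 0) (hw0 : ∀ k, 0 ≤ w k) (hw1 : ∑ k, w k = 1)
    (ht0 : 0 < t) (ht1 : t < 1)
    (hP : ∀ x y, P x y = t * ptGraphSwap (fun _ : Fin (K + 1) => ν) e (fun _ => Equiv.refl S) x y + (1 - t) * prodKernel w M x y)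
    {c : Fin (K + 1) → ℝ} {ρ : ℝ}
    (hvertex : ∀ k : Fin (K + 1), t / m * ∑ r : Fin m, ((if k = (e r).1 then c (e r).2 - c (e r).1 else 0) + (if k = (e r).2 then c (e r).1 - c (e r).2 else 0))
      - (if k = 0 then (1 - t) * w 0 * c 0 else 0) = -ρ * c k)
    (hρ0 : 0 < ρ) (hρ1 : ρ < 1)
    (hconv : ∃ t₀, worstTvDist P (tensorFun (fun _ : Fin (K + 1) => ν)) t₀ ≤ 1 / 4)
    {D : ℝ} (hD0 : 0 < D) (hD : (t / m * ∑ r : Fin m, (c (e r).1 - c (e r).2) ^ 2 + (1 - t) * w 0 * c 0 ^ 2) / ρ ≤ D ^ 2) (u : S) :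
    (1 - ρ) / ρ * Real.log ((1 - ν u) * |∑ k : Fin (K + 1), c k| / (4 * D)) ≤ (mixingTime P (tensorFun (fun _ : Fin (K + 1) => ν)) (1 / 4) : ℝ) := by
  have hμ : ∀ (k : Fin (K + 1)) (v : S), 0 < (fun _ : Fin (K + 1) => ν) k v := fun _ v => hν v
  have hmpos : (0 : ℝ) < m := Nat.cast_pos.mpr (by omega)
  set a : S → ℝ := fun v => (if v = u then (1 : ℝ) else 0) - ν u with ha_def
  set Φ : (Fin (K + 1) → S) → ℝ := fun x => ∑ k : Fin (K + 1), c k * a (x k) with hΦ_def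
  have hΦ : ∀ x, Φ x = ∑ k : Fin (K + 1), c k * a (x k) := fun x => rfl
  have ha0 : ∑ v, ν v * a v = 0 := centredIndicator_mean hν1 u
  have ha : ∀ v v', (a v - a v') ^ 2 ≤ 1 := fun v v' => centredIndicator_diff_sq_le ν u v v'
  have heig : ∀ x, ∑ y, P x y * Φ y = (1 - ρ) * Φ x := graphScheme_oneLevel_eigen e hm he hν hν1 hM0 hidle hw1 hP ha0 hΦ hvertex
  have heig' : ∀ x, |∑ y, P x y * Φ y - (1 - ρ) * Φ x| ≤ 0 := fun x => by rw [heig x, sub_self, abs_zero]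
  set R : ℝ := t / m * ∑ r : Fin m, (c (e r).1 - c (e r).2) ^ 2 + (1 - t) * w 0 * c 0 ^ 2 with hR_def
  have hR0 : 0 ≤ R := by
    have h1 := hw0 0
    have h2 : 0 ≤ 1 - t := by linarith
    have h3 : 0 ≤ ∑ r : Fin m, (c (e r).1 - c (e r).2) ^ 2 := sum_nonneg fun r _ => sq_nonneg _
    rw [hR_def]; positivity
  have hR : ∀ x, ∑ y, P x y * (Φ y - Φ x) ^ 2 ≤ R := fun x =>
    graphScheme_oneLevel_increment_le_energy e hm he hν hν1 hM0 hidle (hw0 0) hw1 ht0.le ht1.le hP hΦ ha x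
  have hD' : (R + 2 * (0 : ℝ) ^ 2 / (1 - (1 - ρ))) / (1 - (1 - ρ)) ≤ D ^ 2 := by
    rw [show 1 - (1 - ρ) = ρ by ring, show R + 2 * (0 : ℝ) ^ 2 / ρ = R by simp]; exact hD
  have hPst := graphScheme_isRowStochastic e hν hν1 hM0 hidle hw0 hw1 ht0.le ht1.le hP
  have hst := (graphScheme_detailedBalance e hν hν1 hM0 hidle hP).isStationary hPst.2
  have hπ0 : ∀ x, 0 ≤ tensorFun (fun _ : Fin (K + 1) => ν) x := fun x => (tensorFun_pos hμ x).le
  have hπ1 : ∑ x, tensorFun (fun _ : Fin (K + 1) => ν) x = 1 := sum_tensorFun_eq_one _ fun _ => hν1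
  have hW := approxEigen_mixingTime_ge (Φ := Φ) (lam := 1 - ρ) (δ := 0) (R := R) hPst heig' (by linarith) (by linarith) hR0 hR hπ0 hπ1 hst hconv hD0 hD'
    (fun _ : Fin (K + 1) => u)
  have hΦ0 : Φ (fun _ : Fin (K + 1) => u) = (1 - ν u) * ∑ k : Fin (K + 1), c k := by
    rw [hΦ, mul_sum]
    exact sum_congr rfl fun k _ => by rw [ha_def]; simp only [if_true]; ring
  have habs : |Φ (fun _ : Fin (K + 1) => u)| = (1 - ν u) * |∑ k : Fin (K + 1), c k| := by
    rw [hΦ0, abs_mul, abs_of_nonneg]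
    have : ν u ≤ 1 := by
      calc ν u ≤ ∑ v, ν v := Finset.single_le_sum (fun v _ => (hν v).le) (mem_univ u)
        _ = 1 := hν1
    linarith
  rw [show 2 * (0 : ℝ) / (1 - (1 - ρ)) + 4 * D = 4 * D by ring, show (1 - ρ) / (1 - (1 - ρ)) = (1 - ρ) / ρ by ring, habs] at hW
  exact hW

/-! ## §3 The closed-form two-sided law from a positive solution -/

/-- **THE SHARP TWO-SIDED LAW FROM A POSITIVE SOLUTION** (weighted scheme `t·ptGraphSwap ν^{⊗} e 1 + (1−t)·prodKernel w M`, idle cold kernels, exact hot sampler, `m ≥ 1`, distinct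
endpoints, `0 < t < 1`, `w_0 > 0`, `h = (1−t)w_0`; `c > 0`, `ρ > 0` solving the vertex equations): for every content `u`,
**`((1−ρ)/ρ)·log((1−ν(u))·Σ_kc_k/(4√(Σ_kc_k²))) ≤ t_mix(1/4) ≤ ⌈(1/ρ)·log(4h/ρ)⌉`**. [ours] -/
theorem graphScheme_sharp_two_sided_mode (hm : 1 ≤ m) (he : ∀ r, (e r).1 ≠ (e r).2) (hν : ∀ v, 0 < ν v) (hν1 : ∑ v, ν v = 1) (hM0 : ∀ u v, M 0 u v = ν v)
    (hidle : ∀ i : Fin K, ∀ u v, M i.succ u v = if v = u then 1 else 0) (hw0 : ∀ k, 0 ≤ w k) (hw00 : 0 < w 0) (hw1 : ∑ k, w k = 1) (ht0 : 0 < t) (ht1 : t < 1)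
    (hP : ∀ x y, P x y = t * ptGraphSwap (fun _ : Fin (K + 1) => ν) e (fun _ => Equiv.refl S) x y + (1 - t) * prodKernel w M x y)
    {c : Fin (K + 1) → ℝ} {ρ : ℝ} (hρ0 : 0 < ρ) (hc : ∀ k, 0 < c k)
    (hvertex : ∀ k : Fin (K + 1), t / m * ∑ r : Fin m, ((if k = (e r).1 then c (e r).2 - c (e r).1 else 0) + (if k = (e r).2 then c (e r).1 - c (e r).2 else 0))
      - (if k = 0 then (1 - t) * w 0 * c k else 0) = -ρ * c k) (u : S) :
    (1 - ρ) / ρ * Real.log ((1 - ν u) * (∑ k : Fin (K + 1), c k) / (4 * Real.sqrt (∑ k : Fin (K + 1), c k ^ 2)))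
        ≤ (mixingTime P (tensorFun (fun _ : Fin (K + 1) => ν)) (1 / 4) : ℝ) ∧
      mixingTime P (tensorFun (fun _ : Fin (K + 1) => ν)) (1 / 4) ≤ ⌈1 / ρ * Real.log (4 * ((1 - t) * w 0) / ρ)⌉₊ := by
  have hh0 : 0 < (1 - t) * w 0 := mul_pos (by linarith) hw00
  have hM := (homLadder_kernels hν hν1 hM0 hidle).1
  have hw01 : w 0 ≤ 1 := by
    calc w 0 ≤ ∑ k, w k := Finset.single_le_sum (fun k _ => hw0 k) (mem_univ 0)
      _ = 1 := hw1
  -- sizes from chapter AI files 1–2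
  have hrho := groundState_rho_le_hot e hc ht0.le hvertex
  have hρ1 : ρ < 1 := by
    have hK1 : (1 : ℝ) ≤ (K : ℝ) + 1 := by have : (0 : ℝ) ≤ K := Nat.cast_nonneg K; linarith
    have h1 : ρ ≤ ρ * ((K : ℝ) + 1) := le_mul_of_one_le_right hρ0.le hK1
    nlinarith
  have hmin := groundState_hot_is_min e hm ht0 hρ0 hc hvertex
  have htr := groundState_trace e hvertex
  have hen := groundState_energy e hvertex
  have hS : 0 < ∑ k : Fin (K + 1), c k := by
    have : c 0 ≤ ∑ k : Fin (K + 1), c k := Finset.single_le_sum (fun k _ => (hc k).le) (mem_univ 0)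
    linarith [hc 0]
  have hS2 : 0 < ∑ k : Fin (K + 1), c k ^ 2 := by
    have : c 0 ^ 2 ≤ ∑ k : Fin (K + 1), c k ^ 2 := Finset.single_le_sum (fun k _ => sq_nonneg (c k)) (mem_univ 0)
    nlinarith [hc 0]
  -- the `c_0` form of the vertex equations
  have hvertex' : ∀ k : Fin (K + 1), t / m * ∑ r : Fin m, ((if k = (e r).1 then c (e r).2 - c (e r).1 else 0) + (if k = (e r).2 then c (e r).1 - c (e r).2 else 0))
      - (if k = 0 then (1 - t) * w 0 * c 0 else 0) = -ρ * c k := by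
    intro k
    have := hvertex k
    by_cases hk : k = 0
    · subst hk; exact this
    · rw [if_neg hk] at this ⊢; exact this
  -- lazy form, ceiling, convergence
  have hPl : ∀ x y, P x y = t * ptGraphProposal e (fun _ => Equiv.refl S) x y + (1 - t) * w 0 * coordKernel M 0 x y + (1 - t - (1 - t) * w 0) * (if y = x then 1 else 0) :=
    fun x y => by rw [hP, graphScheme_lazyForm e hm he hν hidle hw1]
  have hceil := graphScheme_mixingTime_le_mode e (h := (1 - t) * w 0) hm he ht0 hh0 (by nlinarith) hν hν1 hM hM0 hPl hρ0 hρ1.le (hc 0) hmin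
    hvertex' (show (0 : ℝ) < 1 / 4 by norm_num)
  have hconv : ∃ t₀, worstTvDist P (tensorFun (fun _ : Fin (K + 1) => ν)) t₀ ≤ 1 / 4 :=
    ⟨_, graphScheme_worstTvDist_le_of_ge_log e (h := (1 - t) * w 0) hm he ht0 hh0 (by nlinarith) hν hν1 hM hM0 hPl hρ0 hρ1.le (hc 0) hmin
      hvertex' (show (0 : ℝ) < 1 / 4 by norm_num) (Nat.le_ceil _)⟩
  -- the floor with `D = √(Σc²)`
  set D : ℝ := Real.sqrt (∑ k : Fin (K + 1), c k ^ 2) with hD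
  have hD0 : 0 < D := Real.sqrt_pos.mpr hS2
  have hD2 : (t / m * ∑ r : Fin m, (c (e r).1 - c (e r).2) ^ 2 + (1 - t) * w 0 * c 0 ^ 2) / ρ ≤ D ^ 2 := by
    rw [hD, Real.sq_sqrt hS2.le, ← hen]
    field_simp
    exact le_rfl
  have hfloor := graphScheme_mode_mixingTime_ge_energy e hm he hν hν1 hM0 hidle hw0 hw1 ht0 ht1 hP hvertex' hρ0 hρ1 hconv hD0 hD2 u
  rw [abs_of_nonneg hS.le] at hfloor
  -- the ceiling's logarithm: `Σc/(c_0/4) = 4h/ρ`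
  have hlog : (∑ k : Fin (K + 1), c k) / (c 0 * (1 / 4)) = 4 * ((1 - t) * w 0) / ρ := by
    rw [div_eq_div_iff (mul_pos (hc 0) (by norm_num)).ne' hρ0.ne']
    calc (∑ k : Fin (K + 1), c k) * ρ = ρ * ∑ k : Fin (K + 1), c k := mul_comm _ _
      _ = (1 - t) * w 0 * c 0 := htr
      _ = 4 * ((1 - t) * w 0) * (c 0 * (1 / 4)) := by ring
  rw [hlog] at hceil
  exact ⟨hfloor, hceil⟩

/-! ## §4 Every connected list -/

/-- **THE SHARP TWO-SIDED LAW ON EVERY CONNECTED SWAP LIST:** `m ≥ 1`, distinct endpoints, every non-empty proper set of levels crossed by some listed pair, `0 < t < 1`, `w` a probability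
vector with `w_0 > 0`, one positive law `ν`, exact hot sampler, idle cold kernels, `h = (1−t)w_0`; then THE ground state `(c, ρ)` — `c > 0`, `Σc² = 1`, `c_0 = min c`, `0 < ρ ≤ h/(K+1)`,
the vertex equations (the rate is the same for every positive solution, chapter AI file 1) — satisfies, for every content `u`,
**`((1−ρ)/ρ)·log((1−ν(u))·Σ_kc_k/4) ≤ t_mix(1/4) ≤ ⌈(1/ρ)·log(4h/ρ)⌉`**. [ours] -/
theorem graphScheme_sharp_two_sided_exists (hm : 1 ≤ m) (he : ∀ r, (e r).1 ≠ (e r).2)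
    (hconn : ∀ A : Finset (Fin (K + 1)), A.Nonempty → A ≠ univ → ∃ r : Fin m, ((e r).1 ∈ A ∧ (e r).2 ∉ A) ∨ ((e r).2 ∈ A ∧ (e r).1 ∉ A))
    (hν : ∀ v, 0 < ν v) (hν1 : ∑ v, ν v = 1) (hM0 : ∀ u v, M 0 u v = ν v) (hidle : ∀ i : Fin K, ∀ u v, M i.succ u v = if v = u then 1 else 0)
    (hw0 : ∀ k, 0 ≤ w k) (hw00 : 0 < w 0) (hw1 : ∑ k, w k = 1) (ht0 : 0 < t) (ht1 : t < 1)
    (hP : ∀ x y, P x y = t * ptGraphSwap (fun _ : Fin (K + 1) => ν) e (fun _ => Equiv.refl S) x y + (1 - t) * prodKernel w M x y) (u : S) :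
    ∃ (ρ : ℝ) (c : Fin (K + 1) → ℝ), 0 < ρ ∧ ρ ≤ (1 - t) * w 0 / ((K : ℝ) + 1) ∧ (∀ k, 0 < c k) ∧ ∑ k : Fin (K + 1), c k ^ 2 = 1 ∧ (∀ k, c 0 ≤ c k) ∧
      (∀ k : Fin (K + 1), t / m * ∑ r : Fin m, ((if k = (e r).1 then c (e r).2 - c (e r).1 else 0) + (if k = (e r).2 then c (e r).1 - c (e r).2 else 0))
        - (if k = 0 then (1 - t) * w 0 * c k else 0) = -ρ * c k) ∧
      (1 - ρ) / ρ * Real.log ((1 - ν u) * (∑ k : Fin (K + 1), c k) / 4) ≤ (mixingTime P (tensorFun (fun _ : Fin (K + 1) => ν)) (1 / 4) : ℝ) ∧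
      mixingTime P (tensorFun (fun _ : Fin (K + 1) => ν)) (1 / 4) ≤ ⌈1 / ρ * Real.log (4 * ((1 - t) * w 0) / ρ)⌉₊ := by
  have hh0 : 0 < (1 - t) * w 0 := mul_pos (by linarith) hw00
  obtain ⟨c, ρ, hcpos, hcS, hρ0, hρle, hvertex⟩ := graph_groundState_exists e (t := t) (h := (1 - t) * w 0) hm ht0 hh0 hconn
  have hmin := groundState_hot_is_min e hm ht0 hρ0 hcpos hvertex
  have htwo := graphScheme_sharp_two_sided_mode e hm he hν hν1 hM0 hidle hw0 hw00 hw1 ht0 ht1 hP hρ0 hcpos hvertex u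
  rw [hcS, Real.sqrt_one, mul_one] at htwo
  exact ⟨ρ, c, hρ0, hρle, hcpos, hcS, hmin, hvertex, htwo.1, htwo.2⟩

end Summit.Ventures.LatticeQCDFlow.Scaling

end
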